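/-
Copyright (c) 2026. All rights reserved.
Released under Apache 2.0 license as described in the file LICENSE.
Authors: abc-iut cell, seat abc-iut-w5-d053 (gen 4; row «COR37-LOGOBS-GLUE», sub-model instances).
-/
import Literature.AnabelianGeometry.AbsoluteAnabelian.AbsTopIII.BiAnabelianLogGlueFamily
import Literature.AnabelianGeometry.AbsoluteAnabelian.AbsTopIII.BiAnabelianRestriction
import Literature.AnabelianGeometry.AbsoluteAnabelian.AbsTopIII.MLFLogFrobeniusIotaOverGalois
import HarnessLib

/-!
# [AbsTopIII] Cor 3.7 (iii), second clause (cores part) for RESTRICTED settings and for every sub-model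
# `𝒳_P ⊆ 𝒞^{MLF}_{T𝔽}` of the MLF model — zero displayed hypotheses at the model

S. Mochizuki, *Topics in absolute anabelian geometry III* [MochizukiAbsTopIII2015] (kurims manuscript
`paper:url-5493eb38cbb7`), Cor 3.7 (iii) p. 88; Cor 3.7 p. 86 ("the evident restrictions" of the functors to a
full subcategory `𝒞^{MLF-sB}_{T𝔽} ⊆ 𝒞^{MLF}_{T𝔽}`); Def 3.1 (iv) p. 69.

PROOF-ONLY.  The hypotheses (H×), (Hlog) of `logObsCompatCoresStmt_of_iotaOverGal` ("`ι_×`, `ι_log` lie over the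
canonical identifications of Galois groups") pass to abc-iut-w5-d210 lineage's restricted settings
`𝔖.restrict P hP` (`BiAnabelianRestriction.lean`: same `ι`'s and 2-cells, whiskered by the inclusion), so the
cores part of Cor 3.7 (iii), second clause, holds for every restriction of a setting satisfying them — in
particular for EVERY sub-model `(modelSetting p).restrict P` of the MLF model (abc-iut-L4-t5's
`modelSetting_iotaTimes_overGal` / `modelSetting_iotaLog_overGal`, p447746), e.g. the affine sub-model `𝒳_{P₀}`
(`IsAffineModel`, where the lift datum `θ^bi` also exists, `MLFGaloisModelAffineWitnessFull`).
HONEST FRAMING: model-level ≠ node-level; nothing here bears on [IUTchIII] Cor. 3.12.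
-/

set_option autoImplicit false

namespace Literature.AnabelianGeometry.AbsoluteAnabelian.AbsTopIII

open CategoryTheory

universe u

namespace BiAnabelianSetting

variable {X E N : Type u} [Category.{u} X] [Category.{u} E] [Category.{u} N]
  (𝔖 : BiAnabelianSetting X E N) (P : ObjectProperty X) (hP : ∀ A : X, P A → P (𝔖.log.obj A))

/-- (H×) passes to the restricted setting. [cite: MochizukiAbsTopIII2015, Cor 3.7 p.86] -/
theorem restrict_iotaTimes_overGal
    (hT : ∀ y : X, 𝔖.spaceGal.map (𝔖.iotaTimes.app y) = 𝔖.lamTimesGal.hom.app y ≫ 𝔖.lamTimesPfGal.inv.app y)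
    (A : P.FullSubcategory) :
    (𝔖.restrict P hP).spaceGal.map ((𝔖.restrict P hP).iotaTimes.app A) =
      (𝔖.restrict P hP).lamTimesGal.hom.app A ≫ (𝔖.restrict P hP).lamTimesPfGal.inv.app A :=
  hT A.obj

/-- (Hlog) passes to the restricted setting. [cite: MochizukiAbsTopIII2015, Cor 3.7 p.86] -/
theorem restrict_iotaLog_overGal
    (hL : ∀ A : X, 𝔖.spaceGal.map (𝔖.iotaLog.app A) =
      𝔖.lamTimesGal.hom.app (𝔖.log.obj A) ≫ 𝔖.logGal.hom.app A ≫ 𝔖.lamTimesPfGal.inv.app A)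
    (A : P.FullSubcategory) :
    (𝔖.restrict P hP).spaceGal.map ((𝔖.restrict P hP).iotaLog.app A) =
      (𝔖.restrict P hP).lamTimesGal.hom.app ((𝔖.restrict P hP).log.obj A) ≫
        (𝔖.restrict P hP).logGal.hom.app A ≫ (𝔖.restrict P hP).lamTimesPfGal.inv.app A := by
  have h := hL A.obj
  simp only [logGal, Iso.trans_hom, Functor.isoWhiskerRight_hom, NatTrans.comp_app, Functor.whiskerRight_app,
    Functor.leftUnitor_hom_app] at h ⊢
  exact h

/-- **Cor 3.7 (iii), second clause — cores part — for the restricted setting**, under (H×), (Hlog) on `𝔖`.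
[cite: MochizukiAbsTopIII2015, Cor 3.7 (iii) p.88] -/
theorem logObsCompatCoresStmt_restrict
    (hT : ∀ y : X, 𝔖.spaceGal.map (𝔖.iotaTimes.app y) = 𝔖.lamTimesGal.hom.app y ≫ 𝔖.lamTimesPfGal.inv.app y)
    (hL : ∀ A : X, 𝔖.spaceGal.map (𝔖.iotaLog.app A) =
      𝔖.lamTimesGal.hom.app (𝔖.log.obj A) ≫ 𝔖.logGal.hom.app A ≫ 𝔖.lamTimesPfGal.inv.app A) :
    Literature.AnabelianGeometry.AbsoluteAnabelian.AbsTopIII.BiAnabelianSetting.LogObsCompatCoresStmt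
      (𝔖.restrict P hP) :=
  (𝔖.restrict P hP).logObsCompatCoresStmt_of_iotaOverGal (𝔖.restrict_iotaTimes_overGal P hP hT)
    (𝔖.restrict_iotaLog_overGal P hP hL)

end BiAnabelianSetting

namespace TFModel

variable (p : ℕ) [Fact p.Prime]

/-- **Cor 3.7 (iii), second clause — cores part — for EVERY sub-model `𝒳_P` of the MLF model, zero displayed
hypotheses** (e.g. `P = IsAffineModel`, the sub-model where `θ^bi` exists, or `P =` slim).
[cite: MochizukiAbsTopIII2015, Cor 3.7 (iii) p.88] -/
theorem restrict_logObsCompatCoresStmt (P : ObjectProperty (TFModel p)) :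
    Literature.AnabelianGeometry.AbsoluteAnabelian.AbsTopIII.BiAnabelianSetting.LogObsCompatCoresStmt
      ((modelSetting p).restrict P fun _ h => h) :=
  (modelSetting p).logObsCompatCoresStmt_restrict P _ (modelSetting_iotaTimes_overGal p)
    (modelSetting_iotaLog_overGal p)

end TFModel

end Literature.AnabelianGeometry.AbsoluteAnabelian.AbsTopIII
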